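import Mathlib
import Literature.NumberTheory.Irrationality.BrownZudilin2022.CubicalSubstitutionProofs
import HarnessLib

/-!
# Brown–Zudilin 2022, Sect. 3: the passage (1) → (8) PROVED — Literature-side DISCHARGE of `cellularIntegral_eq_cubicalIntegral`

RE-HOMED into Literature (seat bsd-rank2-lit GEN 14, 2026-08-27; HIDDEN-DISCHARGES sweep,
run/shared/lean/pub/bsd-rank2/lit/HIDDEN-DISCHARGES.md): this file is the verbatim concatenation of
`Summits/KontsevichZagierPeriods/Zeta5Search/CellularCubicalMap.lean` and `…/CellularCubicalSubstitution.lean` (cell `pub-zeta5`,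
seat ct-1 g10 — the authors of the mathematics), namespaces `Summit.KontsevichZagierPeriods.Zeta5Search.{CellularCubicalMap,
CellularCubicalSubstitution}` ↦ `Literature.NumberTheory.Irrationality.BrownZudilin2022.{…}`, importing the sibling re-homed file
`CubicalSubstitutionProofs.lean` (eq. (10)); the discharge
`Literature.NumberTheory.Irrationality.BrownZudilin2022.cellularIntegral_eq_cubicalIntegral_holds` is declared next to the fact's
namespace; cite tags added per decl. Theorems only, no definitions. The two original module headers follow as section comments.
-/

/-!
# ζ(5) search — Brown–Zudilin's passage (1) → (8): the map `σ⁵ ∘ c` from the cube to the simplex is a bijection (cell `pub-zeta5`, seat ct-1 g10)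

HONEST FRAMING: systematic search; no irrationality claim unless kernel-certified. Nothing in this file is an irrationality
result, a worthiness exponent or a denominator statement; it is elementary real algebra about an explicit rational map,
the first half of a kernel proof of the named Literature fact `cellularIntegral_eq_cubicalIntegral`
[BrownZudilin2022, Sect. 3, eq. (8)] ("Applying to the integral `I(a)` the fifth power of `σ` and passing from simplicial to
cubical coordinates … we arrive at (8)"), completed in `CellularCubicalSubstitution.lean`.

THE MAP. In the cubical coordinates `x ∈ (0,1)⁵` (indices `0,…,4` for `x₁,…,x₅`) the composite `Ψ = σ⁵ ∘ c` of
`CubicalForm.lean`'s remarks is, in closed form,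
`Ψ(x) = ( x₄(1−x₃)(1−x₅)/((1−x₃x₄)(1−x₄x₅)), x₄(1−x₃)/(1−x₃x₄), (1−x₃)/(1−x₃x₄),
         (1−x₃)(1−x₁x₂x₃x₄)/((1−x₁x₂x₃)(1−x₃x₄)), (1−x₃)(1−x₂x₃x₄)/((1−x₂x₃)(1−x₃x₄)) )`
(written out explicitly in every statement below — no new definition is introduced). PROVED here:

* the DIFFERENCE IDENTITIES `psi_d…`: every difference `tⱼ − tᵢ`, `1 − tⱼ` of the components of `Ψ(x)` that occurs in the
  integrand (1) is a Laurent monomial in the positive atoms `xⱼ, 1−xⱼ, 1−x₁x₂, 1−x₂x₃, 1−x₃x₄, 1−x₄x₅, 1−x₁x₂x₃`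
  (e.g. `t₂ − t₁ = x₄x₅(1−x₃)(1−x₄)/((1−x₃x₄)(1−x₄x₅))`, `1 − t₄ = x₃(1−x₄)(1−x₁x₂)/((1−x₁x₂x₃)(1−x₃x₄))`);
* `psi_mem_openSimplex`: `Ψ` maps the open cube into the open simplex `0 < t₁ < ⋯ < t₅ < 1`;
* the explicit INVERSE `t ↦ ( (t₄−t₃)(t₅−t₂)/((t₄−t₂)(t₅−t₃)), (t₅−t₃)(1−t₂)/((t₅−t₂)(1−t₃)), (1−t₃)/(1−t₂), t₂/t₃,
  t₃(t₂−t₁)/(t₂(t₃−t₁)) )` maps the simplex into the cube (`psiInv_mem_openCube`) and is a two-sided inverse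
  (`psiInv_psi_coord`, `psi_psiInv_coord`);
* hence `psi_image : Ψ '' (0,1)⁵ = openSimplex` and `psi_injOn`.
-/

namespace Literature.NumberTheory.Irrationality.BrownZudilin2022.CellularCubicalMap

open Set
open Literature.NumberTheory.Irrationality.BrownZudilin2022

/-! ### Positivity of the atoms on the cube -/

section coord
variable {x0 x1 x2 x3 x4 : ℝ}

/-- On the open cube the four composite atoms `1−x₃x₄, 1−x₄x₅, 1−x₂x₃, 1−x₁x₂x₃` are positive.
[cite: BrownZudilin2022, Sect. 3, (1)→(8) (σ⁵ and the passage from simplicial to cubical coordinates)] -/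
theorem atoms_pos (h0 : 0 < x0) (h0' : x0 < 1) (h1 : 0 < x1) (h1' : x1 < 1) (h2 : 0 < x2) (h2' : x2 < 1)
    (h3 : 0 < x3) (h3' : x3 < 1) (h4' : x4 < 1) :
    0 < 1 - x2 * x3 ∧ 0 < 1 - x3 * x4 ∧ 0 < 1 - x1 * x2 ∧ 0 < 1 - x0 * x1 * x2 := by
  have p23 : x2 * x3 < 1 := by nlinarith [mul_lt_of_lt_one_right h2 h3']
  have p34 : x3 * x4 < 1 := by nlinarith [mul_lt_of_lt_one_right h3 h4']
  have p12 : x1 * x2 < 1 := by nlinarith [mul_lt_of_lt_one_right h1 h2']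
  have p012 : x0 * x1 * x2 < 1 := by
    have : x0 * (x1 * x2) < 1 := by nlinarith [mul_lt_of_lt_one_right h0 p12, mul_pos h1 h2]
    linarith [mul_assoc x0 x1 x2]
  refine ⟨by linarith, by linarith, by linarith, by linarith⟩

/-! ### The difference identities of the components of `Ψ` -/

/-- `t₂ − t₁ = x₄x₅(1−x₃)(1−x₄)/((1−x₃x₄)(1−x₄x₅))`.
[cite: BrownZudilin2022, Sect. 3, (1)→(8) (σ⁵ and the passage from simplicial to cubical coordinates)] -/
theorem psi_d10 (hP : 1 - x2 * x3 ≠ 0) (hQ : 1 - x3 * x4 ≠ 0) :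
    x3 * (1 - x2) / (1 - x2 * x3) - x3 * (1 - x2) * (1 - x4) / ((1 - x2 * x3) * (1 - x3 * x4))
      = x3 * x4 * (1 - x2) * (1 - x3) / ((1 - x2 * x3) * (1 - x3 * x4)) := by
  rw [div_sub_div _ _ hP (mul_ne_zero hP hQ), div_eq_div_iff (mul_ne_zero hP (mul_ne_zero hP hQ)) (mul_ne_zero hP hQ)]
  ring

/-- `t₃ − t₂ = (1−x₃)(1−x₄)/(1−x₃x₄)`.
[cite: BrownZudilin2022, Sect. 3, (1)→(8) (σ⁵ and the passage from simplicial to cubical coordinates)] -/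
theorem psi_d21 (hP : 1 - x2 * x3 ≠ 0) :
    (1 - x2) / (1 - x2 * x3) - x3 * (1 - x2) / (1 - x2 * x3) = (1 - x2) * (1 - x3) / (1 - x2 * x3) := by
  rw [div_sub_div _ _ hP hP, div_eq_div_iff (mul_ne_zero hP hP) hP]
  ring

/-- `t₄ − t₃ = (1−x₃)(1−x₄)x₁x₂x₃/((1−x₃x₄)(1−x₁x₂x₃))`.
[cite: BrownZudilin2022, Sect. 3, (1)→(8) (σ⁵ and the passage from simplicial to cubical coordinates)] -/
theorem psi_d32 (hP : 1 - x2 * x3 ≠ 0) (hU : 1 - x0 * x1 * x2 ≠ 0) :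
    (1 - x2) * (1 - x0 * x1 * x2 * x3) / ((1 - x0 * x1 * x2) * (1 - x2 * x3)) - (1 - x2) / (1 - x2 * x3)
      = (1 - x2) * (1 - x3) * (x0 * x1 * x2) / ((1 - x2 * x3) * (1 - x0 * x1 * x2)) := by
  rw [div_sub_div _ _ (mul_ne_zero hU hP) hP, div_eq_div_iff (mul_ne_zero (mul_ne_zero hU hP) hP) (mul_ne_zero hP hU)]
  ring

/-- `t₅ − t₄ = (1−x₃)(1−x₄)x₂x₃(1−x₁)/((1−x₃x₄)(1−x₂x₃)(1−x₁x₂x₃))`.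
[cite: BrownZudilin2022, Sect. 3, (1)→(8) (σ⁵ and the passage from simplicial to cubical coordinates)] -/
theorem psi_d43 (hP : 1 - x2 * x3 ≠ 0) (hU : 1 - x0 * x1 * x2 ≠ 0) (hW : 1 - x1 * x2 ≠ 0) :
    (1 - x2) * (1 - x1 * x2 * x3) / ((1 - x1 * x2) * (1 - x2 * x3))
        - (1 - x2) * (1 - x0 * x1 * x2 * x3) / ((1 - x0 * x1 * x2) * (1 - x2 * x3))
      = (1 - x2) * (1 - x3) * (x1 * x2) * (1 - x0) / ((1 - x2 * x3) * (1 - x1 * x2) * (1 - x0 * x1 * x2)) := by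
  rw [div_sub_div _ _ (mul_ne_zero hW hP) (mul_ne_zero hU hP),
    div_eq_div_iff (mul_ne_zero (mul_ne_zero hW hP) (mul_ne_zero hU hP)) (mul_ne_zero (mul_ne_zero hP hW) hU)]
  ring

/-- `1 − t₅ = x₃(1−x₄)(1−x₂)/((1−x₂x₃)(1−x₃x₄))`.
[cite: BrownZudilin2022, Sect. 3, (1)→(8) (σ⁵ and the passage from simplicial to cubical coordinates)] -/
theorem psi_d54 (hP : 1 - x2 * x3 ≠ 0) (hW : 1 - x1 * x2 ≠ 0) :
    1 - (1 - x2) * (1 - x1 * x2 * x3) / ((1 - x1 * x2) * (1 - x2 * x3))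
      = x2 * (1 - x3) * (1 - x1) / ((1 - x1 * x2) * (1 - x2 * x3)) := by
  rw [one_sub_div (mul_ne_zero hW hP), div_eq_div_iff (mul_ne_zero hW hP) (mul_ne_zero hW hP)]
  ring

/-- `t₃ − t₁ = (1−x₃)(1−x₄)/((1−x₃x₄)(1−x₄x₅))`.
[cite: BrownZudilin2022, Sect. 3, (1)→(8) (σ⁵ and the passage from simplicial to cubical coordinates)] -/
theorem psi_d20 (hP : 1 - x2 * x3 ≠ 0) (hQ : 1 - x3 * x4 ≠ 0) :
    (1 - x2) / (1 - x2 * x3) - x3 * (1 - x2) * (1 - x4) / ((1 - x2 * x3) * (1 - x3 * x4))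
      = (1 - x2) * (1 - x3) / ((1 - x2 * x3) * (1 - x3 * x4)) := by
  rw [div_sub_div _ _ hP (mul_ne_zero hP hQ), div_eq_div_iff (mul_ne_zero hP (mul_ne_zero hP hQ)) (mul_ne_zero hP hQ)]
  ring

/-- `1 − t₄ = x₃(1−x₄)(1−x₁x₂)/((1−x₁x₂x₃)(1−x₃x₄))`.
[cite: BrownZudilin2022, Sect. 3, (1)→(8) (σ⁵ and the passage from simplicial to cubical coordinates)] -/
theorem psi_d53 (hP : 1 - x2 * x3 ≠ 0) (hU : 1 - x0 * x1 * x2 ≠ 0) :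
    1 - (1 - x2) * (1 - x0 * x1 * x2 * x3) / ((1 - x0 * x1 * x2) * (1 - x2 * x3))
      = x2 * (1 - x3) * (1 - x0 * x1) / ((1 - x0 * x1 * x2) * (1 - x2 * x3)) := by
  rw [one_sub_div (mul_ne_zero hU hP), div_eq_div_iff (mul_ne_zero hU hP) (mul_ne_zero hU hP)]
  ring

/-- `t₄ − t₂ = (1−x₃)(1−x₄)/((1−x₃x₄)(1−x₁x₂x₃))`.
[cite: BrownZudilin2022, Sect. 3, (1)→(8) (σ⁵ and the passage from simplicial to cubical coordinates)] -/
theorem psi_d31 (hP : 1 - x2 * x3 ≠ 0) (hU : 1 - x0 * x1 * x2 ≠ 0) :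
    (1 - x2) * (1 - x0 * x1 * x2 * x3) / ((1 - x0 * x1 * x2) * (1 - x2 * x3)) - x3 * (1 - x2) / (1 - x2 * x3)
      = (1 - x2) * (1 - x3) / ((1 - x2 * x3) * (1 - x0 * x1 * x2)) := by
  rw [div_sub_div _ _ (mul_ne_zero hU hP) hP, div_eq_div_iff (mul_ne_zero (mul_ne_zero hU hP) hP) (mul_ne_zero hP hU)]
  ring

/-- `t₅ − t₂ = (1−x₃)(1−x₄)/((1−x₃x₄)(1−x₂x₃))`.
[cite: BrownZudilin2022, Sect. 3, (1)→(8) (σ⁵ and the passage from simplicial to cubical coordinates)] -/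
theorem psi_d41 (hP : 1 - x2 * x3 ≠ 0) (hW : 1 - x1 * x2 ≠ 0) :
    (1 - x2) * (1 - x1 * x2 * x3) / ((1 - x1 * x2) * (1 - x2 * x3)) - x3 * (1 - x2) / (1 - x2 * x3)
      = (1 - x2) * (1 - x3) / ((1 - x2 * x3) * (1 - x1 * x2)) := by
  rw [div_sub_div _ _ (mul_ne_zero hW hP) hP, div_eq_div_iff (mul_ne_zero (mul_ne_zero hW hP) hP) (mul_ne_zero hP hW)]
  ring

/-- `t₅ − t₃ = (1−x₃)(1−x₄)x₂x₃/((1−x₃x₄)(1−x₂x₃))`.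
[cite: BrownZudilin2022, Sect. 3, (1)→(8) (σ⁵ and the passage from simplicial to cubical coordinates)] -/
theorem psi_d42 (hP : 1 - x2 * x3 ≠ 0) (hW : 1 - x1 * x2 ≠ 0) :
    (1 - x2) * (1 - x1 * x2 * x3) / ((1 - x1 * x2) * (1 - x2 * x3)) - (1 - x2) / (1 - x2 * x3)
      = (1 - x2) * (1 - x3) * (x1 * x2) / ((1 - x2 * x3) * (1 - x1 * x2)) := by
  rw [div_sub_div _ _ (mul_ne_zero hW hP) hP, div_eq_div_iff (mul_ne_zero (mul_ne_zero hW hP) hP) (mul_ne_zero hP hW)]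
  ring

/-- `1 − t₃ = x₃(1−x₄)/(1−x₃x₄)`.
[cite: BrownZudilin2022, Sect. 3, (1)→(8) (σ⁵ and the passage from simplicial to cubical coordinates)] -/
theorem psi_one_sub2 (hP : 1 - x2 * x3 ≠ 0) : 1 - (1 - x2) / (1 - x2 * x3) = x2 * (1 - x3) / (1 - x2 * x3) := by
  rw [one_sub_div hP]; congr 1; ring

/-- `1 − t₂ = (1−x₄)/(1−x₃x₄)`.
[cite: BrownZudilin2022, Sect. 3, (1)→(8) (σ⁵ and the passage from simplicial to cubical coordinates)] -/
theorem psi_one_sub1 (hP : 1 - x2 * x3 ≠ 0) : 1 - x3 * (1 - x2) / (1 - x2 * x3) = (1 - x3) / (1 - x2 * x3) := by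
  rw [one_sub_div hP]; congr 1; ring

end coord

/-! ### `Ψ` maps the cube into the simplex -/

/-- **`Ψ(x) ∈ openSimplex` for `x ∈ (0,1)⁵`:** `0 < t₁ < t₂ < t₃ < t₄ < t₅ < 1` (each difference is a positive monomial).
[cite: BrownZudilin2022, Sect. 3, (1)→(8) (σ⁵ and the passage from simplicial to cubical coordinates)] -/
theorem psi_mem_openSimplex {x : Fin 5 → ℝ} (hx : x ∈ openCube) :
    ![x 3 * (1 - x 2) * (1 - x 4) / ((1 - x 2 * x 3) * (1 - x 3 * x 4)),
      x 3 * (1 - x 2) / (1 - x 2 * x 3),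
      (1 - x 2) / (1 - x 2 * x 3),
      (1 - x 2) * (1 - x 0 * x 1 * x 2 * x 3) / ((1 - x 0 * x 1 * x 2) * (1 - x 2 * x 3)),
      (1 - x 2) * (1 - x 1 * x 2 * x 3) / ((1 - x 1 * x 2) * (1 - x 2 * x 3))] ∈ openSimplex := by
  obtain ⟨a0, b0⟩ := hx 0; obtain ⟨a1, b1⟩ := hx 1; obtain ⟨a2, b2⟩ := hx 2; obtain ⟨a3, b3⟩ := hx 3
  obtain ⟨a4, b4⟩ := hx 4
  obtain ⟨hP, hQ, hW, hU⟩ := atoms_pos a0 b0 a1 b1 a2 b2 a3 b3 b4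
  have u0 : 0 < 1 - x 0 := by linarith
  have u2 : 0 < 1 - x 2 := by linarith
  have u3 : 0 < 1 - x 3 := by linarith
  have u4 : 0 < 1 - x 4 := by linarith
  have u1 : 0 < 1 - x 1 := by linarith
  simp only [openSimplex, Set.mem_setOf_eq, Matrix.cons_val_zero, Matrix.cons_val_one, Matrix.cons_val]
  refine ⟨by positivity, ?_, ?_, ?_, ?_, ?_⟩
  · rw [← sub_pos, psi_d10 hP.ne' hQ.ne']; positivity
  · rw [← sub_pos, psi_d21 hP.ne']; positivity
  · rw [← sub_pos, psi_d32 hP.ne' hU.ne']; positivity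
  · rw [← sub_pos, psi_d43 hP.ne' hU.ne' hW.ne']; positivity
  · rw [← sub_pos, psi_d54 hP.ne' hW.ne']; positivity

/-! ### The inverse map -/

/-- **Left inverse in coordinates:** the inverse formulas recover `x` from `t = Ψ(x)`.
[cite: BrownZudilin2022, Sect. 3, (1)→(8) (σ⁵ and the passage from simplicial to cubical coordinates)] -/
theorem psiInv_psi_coord (x0 x1 x2 x3 x4 : ℝ) (h1 : 0 < x1) (h2 : 0 < x2) (h3 : 0 < x3) (h2' : x2 < 1) (h3' : x3 < 1)
    (h4' : x4 < 1) (hP : 0 < 1 - x2 * x3) (hQ : 0 < 1 - x3 * x4) (hW : 0 < 1 - x1 * x2) (hU : 0 < 1 - x0 * x1 * x2) :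
    let t0 := x3 * (1 - x2) * (1 - x4) / ((1 - x2 * x3) * (1 - x3 * x4))
    let t1 := x3 * (1 - x2) / (1 - x2 * x3)
    let t2 := (1 - x2) / (1 - x2 * x3)
    let t3 := (1 - x2) * (1 - x0 * x1 * x2 * x3) / ((1 - x0 * x1 * x2) * (1 - x2 * x3))
    let t4 := (1 - x2) * (1 - x1 * x2 * x3) / ((1 - x1 * x2) * (1 - x2 * x3))
    (t3 - t2) * (t4 - t1) / ((t3 - t1) * (t4 - t2)) = x0 ∧ (t4 - t2) * (1 - t1) / ((t4 - t1) * (1 - t2)) = x1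
      ∧ (1 - t2) / (1 - t1) = x2 ∧ t1 / t2 = x3 ∧ t2 * (t1 - t0) / (t1 * (t2 - t0)) = x4 := by
  intro t0 t1 t2 t3 t4
  have u2 : 0 < 1 - x2 := by linarith
  have u3 : 0 < 1 - x3 := by linarith
  have u4 : 0 < 1 - x4 := by linarith
  refine ⟨?_, ?_, ?_, ?_, ?_⟩
  · simp only [t1, t2, t3, t4]
    rw [psi_d32 hP.ne' hU.ne', psi_d41 hP.ne' hW.ne', psi_d31 hP.ne' hU.ne', psi_d42 hP.ne' hW.ne']
    set U := 1 - x0 * x1 * x2 with hUdef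
    set P := 1 - x2 * x3 with hPdef
    set W := 1 - x1 * x2 with hWdef
    field_simp
  · simp only [t1, t2, t4]
    rw [psi_d42 hP.ne' hW.ne', psi_one_sub1 hP.ne', psi_d41 hP.ne' hW.ne', psi_one_sub2 hP.ne']
    set P := 1 - x2 * x3 with hPdef
    set W := 1 - x1 * x2 with hWdef
    field_simp
  · simp only [t1, t2]
    rw [psi_one_sub2 hP.ne', psi_one_sub1 hP.ne']
    set P := 1 - x2 * x3 with hPdef
    field_simp
  · simp only [t1, t2]
    set P := 1 - x2 * x3 with hPdef
    field_simp
  · simp only [t0, t1, t2]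
    rw [psi_d10 hP.ne' hQ.ne', psi_d20 hP.ne' hQ.ne']
    set P := 1 - x2 * x3 with hPdef
    set Q := 1 - x3 * x4 with hQdef
    field_simp

/-- **Right inverse in coordinates:** `Ψ` of the inverse formulas recovers `t` in the simplex.
[cite: BrownZudilin2022, Sect. 3, (1)→(8) (σ⁵ and the passage from simplicial to cubical coordinates)] -/
theorem psi_psiInv_coord (t0 t1 t2 t3 t4 : ℝ) (h0 : 0 < t0) (h01 : t0 < t1) (h12 : t1 < t2) (h23 : t2 < t3)
    (h34 : t3 < t4) (h4 : t4 < 1) :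
    let x0 := (t3 - t2) * (t4 - t1) / ((t3 - t1) * (t4 - t2))
    let x1 := (t4 - t2) * (1 - t1) / ((t4 - t1) * (1 - t2))
    let x2 := (1 - t2) / (1 - t1)
    let x3 := t1 / t2
    let x4 := t2 * (t1 - t0) / (t1 * (t2 - t0))
    x3 * (1 - x2) * (1 - x4) / ((1 - x2 * x3) * (1 - x3 * x4)) = t0 ∧ x3 * (1 - x2) / (1 - x2 * x3) = t1
      ∧ (1 - x2) / (1 - x2 * x3) = t2
      ∧ (1 - x2) * (1 - x0 * x1 * x2 * x3) / ((1 - x0 * x1 * x2) * (1 - x2 * x3)) = t3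
      ∧ (1 - x2) * (1 - x1 * x2 * x3) / ((1 - x1 * x2) * (1 - x2 * x3)) = t4 := by
  intro x0 x1 x2 x3 x4
  have e10 : t1 - t0 ≠ 0 := by linarith
  have e21 : t2 - t1 ≠ 0 := by linarith
  have e20 : t2 - t0 ≠ 0 := by linarith
  have e31 : t3 - t1 ≠ 0 := by linarith
  have e32 : t3 - t2 ≠ 0 := by linarith
  have e42 : t4 - t2 ≠ 0 := by linarith
  have e41 : t4 - t1 ≠ 0 := by linarith
  have n1 : 1 - t1 ≠ 0 := by linarith
  have n2 : 1 - t2 ≠ 0 := by linarith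
  have ht1 : t1 ≠ 0 := by linarith
  have ht2 : t2 ≠ 0 := by linarith
  have E1 : 1 - x2 * x3 = (t2 - t1) / ((1 - t1) * t2) := by
    simp only [x2, x3]; rw [eq_div_iff (mul_ne_zero n1 ht2)]; field_simp; ring
  have E2 : 1 - x3 * x4 = (t2 - t1) / (t2 - t0) := by
    simp only [x3, x4]; rw [eq_div_iff e20]; field_simp; ring
  have E3 : 1 - x2 = (t2 - t1) / (1 - t1) := by
    simp only [x2]; rw [eq_div_iff n1]; field_simp; ring
  have E4 : 1 - x4 = t0 * (t2 - t1) / (t1 * (t2 - t0)) := by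
    simp only [x4]; rw [eq_div_iff (mul_ne_zero ht1 e20)]; field_simp; ring
  have E5 : x0 * x1 * x2 = (t3 - t2) / (t3 - t1) := by
    simp only [x0, x1, x2]; rw [eq_div_iff e31]; field_simp
  have E6 : x1 * x2 = (t4 - t2) / (t4 - t1) := by
    simp only [x1, x2]; rw [eq_div_iff e41]; field_simp
  have E7 : 1 - (t3 - t2) / (t3 - t1) = (t2 - t1) / (t3 - t1) := by
    rw [one_sub_div e31]; congr 1; ring
  have E8 : 1 - (t3 - t2) / (t3 - t1) * (t1 / t2) = t3 * (t2 - t1) / ((t3 - t1) * t2) := by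
    rw [div_mul_div_comm, one_sub_div (mul_ne_zero e31 ht2)]; congr 1; ring
  have E9 : 1 - (t4 - t2) / (t4 - t1) = (t2 - t1) / (t4 - t1) := by
    rw [one_sub_div e41]; congr 1; ring
  have E10 : 1 - (t4 - t2) / (t4 - t1) * (t1 / t2) = t4 * (t2 - t1) / ((t4 - t1) * t2) := by
    rw [div_mul_div_comm, one_sub_div (mul_ne_zero e41 ht2)]; congr 1; ring
  refine ⟨?_, ?_, ?_, ?_, ?_⟩
  · rw [E1, E2, E3, E4]; simp only [x3]
    rw [div_eq_iff (by positivity)]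
    field_simp
  · rw [E1, E3]; simp only [x3]
    rw [div_eq_iff (by positivity)]
    field_simp
  · rw [E1, E3]
    rw [div_eq_iff (by positivity)]
    field_simp
  · rw [show x0 * x1 * x2 * x3 = (x0 * x1 * x2) * x3 by ring, E5, E1, E3]; simp only [x3]
    rw [E7, E8, div_eq_iff (by positivity)]
    field_simp
  · rw [show x1 * x2 * x3 = (x1 * x2) * x3 by ring, E6, E1, E3]; simp only [x3]
    rw [E9, E10, div_eq_iff (by positivity)]
    field_simp

/-- **The inverse formulas map the simplex into the cube.**
[cite: BrownZudilin2022, Sect. 3, (1)→(8) (σ⁵ and the passage from simplicial to cubical coordinates)] -/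
theorem psiInv_mem_openCube {t : Fin 5 → ℝ} (ht : t ∈ openSimplex) :
    ![(t 3 - t 2) * (t 4 - t 1) / ((t 3 - t 1) * (t 4 - t 2)), (t 4 - t 2) * (1 - t 1) / ((t 4 - t 1) * (1 - t 2)),
      (1 - t 2) / (1 - t 1), t 1 / t 2, t 2 * (t 1 - t 0) / (t 1 * (t 2 - t 0))] ∈ openCube := by
  obtain ⟨h0, h01, h12, h23, h34, h4⟩ := ht
  have d10 : 0 < t 1 - t 0 := by linarith
  have d21 : 0 < t 2 - t 1 := by linarith
  have d20 : 0 < t 2 - t 0 := by linarith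
  have d31 : 0 < t 3 - t 1 := by linarith
  have d32 : 0 < t 3 - t 2 := by linarith
  have d42 : 0 < t 4 - t 2 := by linarith
  have d41 : 0 < t 4 - t 1 := by linarith
  have d43 : 0 < t 4 - t 3 := by linarith
  have n1 : 0 < 1 - t 1 := by linarith
  have n2 : 0 < 1 - t 2 := by linarith
  have n4 : 0 < 1 - t 4 := by linarith
  have ht1 : 0 < t 1 := by linarith
  have ht2 : 0 < t 2 := by linarith
  have c0 : 0 < (t 3 - t 2) * (t 4 - t 1) / ((t 3 - t 1) * (t 4 - t 2))
      ∧ (t 3 - t 2) * (t 4 - t 1) / ((t 3 - t 1) * (t 4 - t 2)) < 1 := by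
    refine ⟨by positivity, ?_⟩
    rw [div_lt_one (by positivity)]
    nlinarith [mul_pos d21 d43]
  have c1 : 0 < (t 4 - t 2) * (1 - t 1) / ((t 4 - t 1) * (1 - t 2))
      ∧ (t 4 - t 2) * (1 - t 1) / ((t 4 - t 1) * (1 - t 2)) < 1 := by
    refine ⟨by positivity, ?_⟩
    rw [div_lt_one (by positivity)]
    nlinarith [mul_pos d21 n4]
  have c2 : 0 < (1 - t 2) / (1 - t 1) ∧ (1 - t 2) / (1 - t 1) < 1 := by
    refine ⟨by positivity, ?_⟩
    rw [div_lt_one n1]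
    linarith
  have c3 : 0 < t 1 / t 2 ∧ t 1 / t 2 < 1 := by
    refine ⟨by positivity, ?_⟩
    rw [div_lt_one ht2]
    exact h12
  have c4 : 0 < t 2 * (t 1 - t 0) / (t 1 * (t 2 - t 0)) ∧ t 2 * (t 1 - t 0) / (t 1 * (t 2 - t 0)) < 1 := by
    refine ⟨by positivity, ?_⟩
    rw [div_lt_one (by positivity)]
    nlinarith [mul_pos h0 d21]
  intro i
  fin_cases i
  · exact c0
  · exact c1
  · exact c2
  · exact c3
  · exact c4

/-! ### Bijectivity of `Ψ : (0,1)⁵ → openSimplex` -/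

/-- **`Ψ` maps the open cube ONTO the open simplex.**
[cite: BrownZudilin2022, Sect. 3, (1)→(8) (σ⁵ and the passage from simplicial to cubical coordinates)] -/
theorem psi_image :
    (fun x : Fin 5 → ℝ => ![x 3 * (1 - x 2) * (1 - x 4) / ((1 - x 2 * x 3) * (1 - x 3 * x 4)),
        x 3 * (1 - x 2) / (1 - x 2 * x 3),
        (1 - x 2) / (1 - x 2 * x 3),
        (1 - x 2) * (1 - x 0 * x 1 * x 2 * x 3) / ((1 - x 0 * x 1 * x 2) * (1 - x 2 * x 3)),
        (1 - x 2) * (1 - x 1 * x 2 * x 3) / ((1 - x 1 * x 2) * (1 - x 2 * x 3))]) '' openCube = openSimplex := by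
  refine Subset.antisymm ?_ ?_
  · rintro _ ⟨x, hx, rfl⟩
    exact psi_mem_openSimplex hx
  · intro t ht
    refine ⟨_, psiInv_mem_openCube ht, ?_⟩
    obtain ⟨h0, h01, h12, h23, h34, h4⟩ := ht
    obtain ⟨c0, c1, c2, c3, c4⟩ := psi_psiInv_coord (t 0) (t 1) (t 2) (t 3) (t 4) h0 h01 h12 h23 h34 h4
    simp only [Matrix.cons_val_zero, Matrix.cons_val_one, Matrix.cons_val]
    rw [c0, c1, c2, c3, c4]
    ext i; fin_cases i <;> simp

/-- **`Ψ` is injective on the open cube.**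
[cite: BrownZudilin2022, Sect. 3, (1)→(8) (σ⁵ and the passage from simplicial to cubical coordinates)] -/
theorem psi_injOn :
    InjOn (fun x : Fin 5 → ℝ => ![x 3 * (1 - x 2) * (1 - x 4) / ((1 - x 2 * x 3) * (1 - x 3 * x 4)),
        x 3 * (1 - x 2) / (1 - x 2 * x 3),
        (1 - x 2) / (1 - x 2 * x 3),
        (1 - x 2) * (1 - x 0 * x 1 * x 2 * x 3) / ((1 - x 0 * x 1 * x 2) * (1 - x 2 * x 3)),
        (1 - x 2) * (1 - x 1 * x 2 * x 3) / ((1 - x 1 * x 2) * (1 - x 2 * x 3))]) openCube := by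
  -- the inverse formulas give a left inverse on the cube
  have key : ∀ x ∈ openCube, ∀ i : Fin 5, x i =
      ![((1 - x 2) * (1 - x 0 * x 1 * x 2 * x 3) / ((1 - x 0 * x 1 * x 2) * (1 - x 2 * x 3)) - (1 - x 2) / (1 - x 2 * x 3))
          * ((1 - x 2) * (1 - x 1 * x 2 * x 3) / ((1 - x 1 * x 2) * (1 - x 2 * x 3)) - x 3 * (1 - x 2) / (1 - x 2 * x 3))
          / (((1 - x 2) * (1 - x 0 * x 1 * x 2 * x 3) / ((1 - x 0 * x 1 * x 2) * (1 - x 2 * x 3))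
                - x 3 * (1 - x 2) / (1 - x 2 * x 3))
              * ((1 - x 2) * (1 - x 1 * x 2 * x 3) / ((1 - x 1 * x 2) * (1 - x 2 * x 3)) - (1 - x 2) / (1 - x 2 * x 3))),
        ((1 - x 2) * (1 - x 1 * x 2 * x 3) / ((1 - x 1 * x 2) * (1 - x 2 * x 3)) - (1 - x 2) / (1 - x 2 * x 3))
          * (1 - x 3 * (1 - x 2) / (1 - x 2 * x 3))
          / (((1 - x 2) * (1 - x 1 * x 2 * x 3) / ((1 - x 1 * x 2) * (1 - x 2 * x 3)) - x 3 * (1 - x 2) / (1 - x 2 * x 3))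
              * (1 - (1 - x 2) / (1 - x 2 * x 3))),
        (1 - (1 - x 2) / (1 - x 2 * x 3)) / (1 - x 3 * (1 - x 2) / (1 - x 2 * x 3)),
        x 3 * (1 - x 2) / (1 - x 2 * x 3) / ((1 - x 2) / (1 - x 2 * x 3)),
        (1 - x 2) / (1 - x 2 * x 3) * (x 3 * (1 - x 2) / (1 - x 2 * x 3)
            - x 3 * (1 - x 2) * (1 - x 4) / ((1 - x 2 * x 3) * (1 - x 3 * x 4)))
          / (x 3 * (1 - x 2) / (1 - x 2 * x 3)
              * ((1 - x 2) / (1 - x 2 * x 3) - x 3 * (1 - x 2) * (1 - x 4) / ((1 - x 2 * x 3) * (1 - x 3 * x 4))))] i := by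
    intro x hx
    obtain ⟨a0, b0⟩ := hx 0; obtain ⟨a1, b1⟩ := hx 1; obtain ⟨a2, b2⟩ := hx 2; obtain ⟨a3, b3⟩ := hx 3
    obtain ⟨a4, b4⟩ := hx 4
    obtain ⟨hP, hQ, hW, hU⟩ := atoms_pos a0 b0 a1 b1 a2 b2 a3 b3 b4
    obtain ⟨c0, c1, c2, c3, c4⟩ := psiInv_psi_coord (x 0) (x 1) (x 2) (x 3) (x 4) a1 a2 a3 b2 b3 b4 hP hQ hW hU
    intro i
    fin_cases i
    · simpa using c0.symm
    · simpa using c1.symm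
    · simpa using c2.symm
    · simpa using c3.symm
    · simpa using c4.symm
  intro x hx y hy hxy
  have h := fun i => congrFun hxy i
  have e0 := h 0; have e1 := h 1; have e2 := h 2; have e3 := h 3; have e4 := h 4
  simp only [Matrix.cons_val_zero, Matrix.cons_val_one, Matrix.cons_val] at e0 e1 e2 e3 e4
  ext i
  rw [key x hx i, key y hy i]
  fin_cases i <;> simp [e0, e1, e2, e3, e4]

end Literature.NumberTheory.Irrationality.BrownZudilin2022.CellularCubicalMap

/-!
# ζ(5) search — Brown–Zudilin's cubical form (8) PROVED: `cellularIntegral_eq_cubicalIntegral` holds (cell `pub-zeta5`, seat ct-1 g10)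

HONEST FRAMING: systematic search; no irrationality claim unless kernel-certified. Nothing in this file is an irrationality
result, a worthiness exponent or a denominator statement. It DISCHARGES the named Literature fact
`Literature.NumberTheory.Irrationality.BrownZudilin2022.cellularIntegral_eq_cubicalIntegral` [BrownZudilin2022, Sect. 3, eq. (8)]
("Applying to the integral `I(a) = I(a₁,…,a₈)` the fifth power of `σ` and passing from simplicial to cubical coordinates … we
arrive at the integral (8)"; the source omits the finite calculation, `CubicalForm.lean` typed the statement only):
for EVERY `a : Fin 8 → ℤ` (no convergence hypothesis — both sides are Bochner integrals and the change of variables needs no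
integrability) the simplicial integral (1) `cellularIntegral a = ∫_{openSimplex} integrand a` equals the cubical integral (8)
`cubicalIntegral a = ∫_{(0,1)⁵} cubicalIntegrand a` (`cellularIntegral_eq_cubicalIntegral_all`, `cellularIntegral_eq_cubicalIntegral_holds`).

Proof. The map `Ψ = σ⁵ ∘ c` (closed form and bijectivity `(0,1)⁵ → openSimplex` in `CellularCubicalMap.lean`) is differentiable on
the cube; its derivative is the continuous linear map with the fourteen non-zero partial derivatives listed in `hasFDerivAt_psi`,
and its Jacobian determinant is `−x₂x₃²x₄(1−x₃)⁴(1−x₄)⁴/((1−x₁x₂x₃)²(1−x₂x₃)²(1−x₃x₄)⁶(1−x₄x₅)²)` (the value recorded in the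
remarks of `CubicalForm.lean`; `det_pattern14` expands the sparse `5 × 5` determinant). The POINTWISE identity
`|det DΨ(x)| · integrand a (Ψ x) = cubicalIntegrand a x` (`integrand_psi`) is an identity of Laurent monomials in the positive
atoms `xⱼ, 1−xⱼ, 1−x₁x₂, 1−x₂x₃, 1−x₃x₄, 1−x₄x₅, 1−x₁x₂x₃`, obtained from the difference identities of `CellularCubicalMap.lean`
and proved by comparing logarithms. Mathlib's `integral_image_eq_integral_abs_det_fderiv_smul` concludes.

Consequence for the tree: with `CubicalSubstitution.cubicalIntegral_eq_Jintegral_holds` (eq. (10)) BOTH hypotheses `h8`, `h10`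
("F1") of the gen-1 (H1)-free cellular-relation files `WedgeDictionaryKernel{Cells,Atlas,Trans}*` are now theorems; those files
keep only F2 = `barnes_double` (the Barnes representation (16)) as a named-fact input.
-/

namespace Literature.NumberTheory.Irrationality.BrownZudilin2022.CellularCubicalSubstitution

open MeasureTheory Set
open ContinuousLinearMap (proj)
open Literature.NumberTheory.Irrationality.BrownZudilin2022
open Literature.NumberTheory.Irrationality.BrownZudilin2022.CellularCubicalMap

/-! ### Derivatives of the components of `Ψ` -/

/-- Quotient rule for real functions on `ℝ⁵`.
[cite: BrownZudilin2022, Sect. 3, (1)→(8) (σ⁵ and the passage from simplicial to cubical coordinates)] -/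
theorem hasFDerivAt_div' {f g : (Fin 5 → ℝ) → ℝ} {f' g' : (Fin 5 → ℝ) →L[ℝ] ℝ} {x : Fin 5 → ℝ}
    (hf : HasFDerivAt f f' x) (hg : HasFDerivAt g g' x) (hg0 : g x ≠ 0) :
    HasFDerivAt (fun y => f y / g y) ((g x)⁻¹ • f' - (f x / g x ^ 2) • g') x := by
  have h := hf.mul ((hasFDerivAt_inv hg0).comp x hg)
  refine HasFDerivAt.congr_fderiv (h.congr_of_eventuallyEq ?_) ?_
  · exact Filter.Eventually.of_forall fun z => by simp [div_eq_mul_inv]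
  · ext v
    simp
    ring

/-- The coordinate functions are their own derivatives.
[cite: BrownZudilin2022, Sect. 3, (1)→(8) (σ⁵ and the passage from simplicial to cubical coordinates)] -/
theorem hasFDerivAt_coord (i : Fin 5) (x : Fin 5 → ℝ) :
    HasFDerivAt (fun y : Fin 5 → ℝ => y i) (proj i : (Fin 5 → ℝ) →L[ℝ] ℝ) x :=
  hasFDerivAt_apply (𝕜 := ℝ) i x

/-- Derivative of `Ψ₃ = (1 − x₃)/(1 − x₃x₄)`.
[cite: BrownZudilin2022, Sect. 3, (1)→(8) (σ⁵ and the passage from simplicial to cubical coordinates)] -/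
theorem hasFDerivAt_psi2 (x : Fin 5 → ℝ) (hP : 1 - x 2 * x 3 ≠ 0) :
    HasFDerivAt (fun y : Fin 5 → ℝ => (1 - y 2) / (1 - y 2 * y 3))
      (((x 3 - 1) / (1 - x 2 * x 3) ^ 2) • (proj 2 : (Fin 5 → ℝ) →L[ℝ] ℝ)
        + ((1 - x 2) * x 2 / (1 - x 2 * x 3) ^ 2) • (proj 3 : (Fin 5 → ℝ) →L[ℝ] ℝ)) x := by
  have hN := (hasFDerivAt_coord 2 x).const_sub 1
  have hD := ((hasFDerivAt_coord 2 x).mul (hasFDerivAt_coord 3 x)).const_sub 1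
  refine HasFDerivAt.congr_fderiv ((hasFDerivAt_div' hN hD hP).congr_of_eventuallyEq ?_) ?_
  · exact Filter.Eventually.of_forall fun z => by simp
  · ext v
    simp
    field_simp
    ring

/-- Derivative of `Ψ₂ = x₄(1 − x₃)/(1 − x₃x₄)`.
[cite: BrownZudilin2022, Sect. 3, (1)→(8) (σ⁵ and the passage from simplicial to cubical coordinates)] -/
theorem hasFDerivAt_psi1 (x : Fin 5 → ℝ) (hP : 1 - x 2 * x 3 ≠ 0) :
    HasFDerivAt (fun y : Fin 5 → ℝ => y 3 * (1 - y 2) / (1 - y 2 * y 3))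
      ((x 3 * (x 3 - 1) / (1 - x 2 * x 3) ^ 2) • (proj 2 : (Fin 5 → ℝ) →L[ℝ] ℝ)
        + ((1 - x 2) / (1 - x 2 * x 3) ^ 2) • (proj 3 : (Fin 5 → ℝ) →L[ℝ] ℝ)) x := by
  have hN := (hasFDerivAt_coord 3 x).mul ((hasFDerivAt_coord 2 x).const_sub 1)
  have hD := ((hasFDerivAt_coord 2 x).mul (hasFDerivAt_coord 3 x)).const_sub 1
  refine HasFDerivAt.congr_fderiv ((hasFDerivAt_div' hN hD hP).congr_of_eventuallyEq ?_) ?_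
  · exact Filter.Eventually.of_forall fun z => by simp
  · ext v
    simp
    field_simp
    ring

/-- Derivative of `Ψ₁ = x₄(1 − x₃)(1 − x₅)/((1 − x₃x₄)(1 − x₄x₅))`.
[cite: BrownZudilin2022, Sect. 3, (1)→(8) (σ⁵ and the passage from simplicial to cubical coordinates)] -/
theorem hasFDerivAt_psi0 (x : Fin 5 → ℝ) (hP : 1 - x 2 * x 3 ≠ 0) (hQ : 1 - x 3 * x 4 ≠ 0) :
    HasFDerivAt (fun y : Fin 5 → ℝ => y 3 * (1 - y 2) * (1 - y 4) / ((1 - y 2 * y 3) * (1 - y 3 * y 4)))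
      ((x 3 * (x 3 - 1) * (1 - x 4) / ((1 - x 2 * x 3) ^ 2 * (1 - x 3 * x 4))) • (proj 2 : (Fin 5 → ℝ) →L[ℝ] ℝ)
        + ((1 - x 2) * (1 - x 4) * (1 - x 2 * x 3 ^ 2 * x 4) / ((1 - x 2 * x 3) ^ 2 * (1 - x 3 * x 4) ^ 2)) •
            (proj 3 : (Fin 5 → ℝ) →L[ℝ] ℝ)
        + ((x 3 * (1 - x 2) * (x 3 - 1)) / ((1 - x 2 * x 3) * (1 - x 3 * x 4) ^ 2)) • (proj 4 : (Fin 5 → ℝ) →L[ℝ] ℝ))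
      x := by
  have hN := ((hasFDerivAt_coord 3 x).mul ((hasFDerivAt_coord 2 x).const_sub 1)).mul
    ((hasFDerivAt_coord 4 x).const_sub 1)
  have hD := (((hasFDerivAt_coord 2 x).mul (hasFDerivAt_coord 3 x)).const_sub 1).mul
    (((hasFDerivAt_coord 3 x).mul (hasFDerivAt_coord 4 x)).const_sub 1)
  refine HasFDerivAt.congr_fderiv ((hasFDerivAt_div' hN hD (mul_ne_zero hP hQ)).congr_of_eventuallyEq ?_) ?_
  · exact Filter.Eventually.of_forall fun z => by simp
  · ext v
    simp
    field_simp
    ring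

/-- Derivative of `Ψ₄ = (1 − x₃)(1 − x₁x₂x₃x₄)/((1 − x₁x₂x₃)(1 − x₃x₄))`.
[cite: BrownZudilin2022, Sect. 3, (1)→(8) (σ⁵ and the passage from simplicial to cubical coordinates)] -/
theorem hasFDerivAt_psi3 (x : Fin 5 → ℝ) (hP : 1 - x 2 * x 3 ≠ 0) (hU : 1 - x 0 * x 1 * x 2 ≠ 0) :
    HasFDerivAt (fun y : Fin 5 → ℝ => (1 - y 2) * (1 - y 0 * y 1 * y 2 * y 3) / ((1 - y 0 * y 1 * y 2) * (1 - y 2 * y 3)))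
      (((1 - x 2) * (1 - x 3) * x 1 * x 2 / ((1 - x 2 * x 3) * (1 - x 0 * x 1 * x 2) ^ 2)) • (proj 0 : (Fin 5 → ℝ) →L[ℝ] ℝ)
        + ((1 - x 2) * (1 - x 3) * x 0 * x 2 / ((1 - x 2 * x 3) * (1 - x 0 * x 1 * x 2) ^ 2)) •
            (proj 1 : (Fin 5 → ℝ) →L[ℝ] ℝ)
        + ((x 3 - 1) * (1 - x 0 * x 1) * (1 - x 0 * x 1 * x 2 ^ 2 * x 3) / ((1 - x 2 * x 3) ^ 2 * (1 - x 0 * x 1 * x 2) ^ 2)) •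
            (proj 2 : (Fin 5 → ℝ) →L[ℝ] ℝ)
        + ((1 - x 2) * x 2 * (1 - x 0 * x 1) / ((1 - x 2 * x 3) ^ 2 * (1 - x 0 * x 1 * x 2))) •
            (proj 3 : (Fin 5 → ℝ) →L[ℝ] ℝ)) x := by
  have hN := ((hasFDerivAt_coord 2 x).const_sub 1).mul
    (((((hasFDerivAt_coord 0 x).mul (hasFDerivAt_coord 1 x)).mul (hasFDerivAt_coord 2 x)).mul
      (hasFDerivAt_coord 3 x)).const_sub 1)
  have hD := ((((hasFDerivAt_coord 0 x).mul (hasFDerivAt_coord 1 x)).mul (hasFDerivAt_coord 2 x)).const_sub 1).mul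
    (((hasFDerivAt_coord 2 x).mul (hasFDerivAt_coord 3 x)).const_sub 1)
  refine HasFDerivAt.congr_fderiv ((hasFDerivAt_div' hN hD (mul_ne_zero hU hP)).congr_of_eventuallyEq ?_) ?_
  · exact Filter.Eventually.of_forall fun z => by simp
  · ext v
    simp
    field_simp
    ring

/-- Derivative of `Ψ₅ = (1 − x₃)(1 − x₂x₃x₄)/((1 − x₂x₃)(1 − x₃x₄))`.
[cite: BrownZudilin2022, Sect. 3, (1)→(8) (σ⁵ and the passage from simplicial to cubical coordinates)] -/
theorem hasFDerivAt_psi4 (x : Fin 5 → ℝ) (hP : 1 - x 2 * x 3 ≠ 0) (hW : 1 - x 1 * x 2 ≠ 0) :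
    HasFDerivAt (fun y : Fin 5 → ℝ => (1 - y 2) * (1 - y 1 * y 2 * y 3) / ((1 - y 1 * y 2) * (1 - y 2 * y 3)))
      (((1 - x 2) * (1 - x 3) * x 2 / ((1 - x 2 * x 3) * (1 - x 1 * x 2) ^ 2)) • (proj 1 : (Fin 5 → ℝ) →L[ℝ] ℝ)
        + ((x 3 - 1) * (1 - x 1) * (1 - x 1 * x 2 ^ 2 * x 3) / ((1 - x 2 * x 3) ^ 2 * (1 - x 1 * x 2) ^ 2)) •
            (proj 2 : (Fin 5 → ℝ) →L[ℝ] ℝ)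
        + ((1 - x 2) * x 2 * (1 - x 1) / ((1 - x 2 * x 3) ^ 2 * (1 - x 1 * x 2))) •
            (proj 3 : (Fin 5 → ℝ) →L[ℝ] ℝ)) x := by
  have hN := ((hasFDerivAt_coord 2 x).const_sub 1).mul
    ((((hasFDerivAt_coord 1 x).mul (hasFDerivAt_coord 2 x)).mul (hasFDerivAt_coord 3 x)).const_sub 1)
  have hD := (((hasFDerivAt_coord 1 x).mul (hasFDerivAt_coord 2 x)).const_sub 1).mul
    (((hasFDerivAt_coord 2 x).mul (hasFDerivAt_coord 3 x)).const_sub 1)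
  refine HasFDerivAt.congr_fderiv ((hasFDerivAt_div' hN hD (mul_ne_zero hW hP)).congr_of_eventuallyEq ?_) ?_
  · exact Filter.Eventually.of_forall fun z => by simp
  · ext v
    simp
    field_simp
    ring

/-- Determinant of a `5 × 5` matrix with the zero pattern of `DΨ`.
[cite: BrownZudilin2022, Sect. 3, (1)→(8) (σ⁵ and the passage from simplicial to cubical coordinates)] -/
theorem det_pattern14 (a b c d e f g h i j k l m n : ℝ) :
    Matrix.det !![0, 0, a, b, c; 0, 0, d, e, 0; 0, 0, f, g, 0; h, i, j, k, 0; 0, l, m, n, 0]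
      = h * l * c * (d * g - e * f) := by
  have s12 : (Fin.succAbove (1 : Fin 5) (2 : Fin 4)) = 3 := by decide
  have s13 : (Fin.succAbove (1 : Fin 5) (3 : Fin 4)) = 4 := by decide
  have s23 : (Fin.succAbove (2 : Fin 5) (3 : Fin 4)) = 4 := by decide
  have s22 : (Fin.succAbove (2 : Fin 5) (2 : Fin 4)) = 3 := by decide
  have s32 : (Fin.succAbove (3 : Fin 5) (2 : Fin 4)) = 2 := by decide
  have s33 : (Fin.succAbove (3 : Fin 5) (3 : Fin 4)) = 4 := by decide
  have s42 : (Fin.succAbove (4 : Fin 5) (2 : Fin 4)) = 2 := by decide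
  have s43 : (Fin.succAbove (4 : Fin 5) (3 : Fin 4)) = 3 := by decide
  have t12 : (Fin.succAbove (1 : Fin 4) (2 : Fin 3)) = 3 := by decide
  have t22 : (Fin.succAbove (2 : Fin 4) (2 : Fin 3)) = 3 := by decide
  have t32 : (Fin.succAbove (3 : Fin 4) (2 : Fin 3)) = 2 := by decide
  simp [Matrix.det_succ_row_zero, Fin.sum_univ_succ, Matrix.submatrix, s12, s13, s23, s22, s32, s33, s42, s43, t12, t22, t32]
  ring

/-- **`Ψ` is differentiable on the cube, with Jacobian determinant
`det DΨ(x) = −x₂x₃²x₄(1−x₃)⁴(1−x₄)⁴/((1−x₁x₂x₃)²(1−x₂x₃)²(1−x₃x₄)⁶(1−x₄x₅)²)`** (the value recorded in `CubicalForm.lean`'s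
remarks). The derivative is the continuous linear map whose rows are the fourteen partial derivatives below.
[cite: BrownZudilin2022, Sect. 3, (1)→(8) (σ⁵ and the passage from simplicial to cubical coordinates)] -/
theorem hasFDerivAt_psi (x : Fin 5 → ℝ) (hP : 1 - x 2 * x 3 ≠ 0) (hQ : 1 - x 3 * x 4 ≠ 0) (hW : 1 - x 1 * x 2 ≠ 0)
    (hU : 1 - x 0 * x 1 * x 2 ≠ 0) :
    ∃ f' : (Fin 5 → ℝ) →L[ℝ] (Fin 5 → ℝ),
      HasFDerivAt (fun x : Fin 5 → ℝ => ![x 3 * (1 - x 2) * (1 - x 4) / ((1 - x 2 * x 3) * (1 - x 3 * x 4)),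
          x 3 * (1 - x 2) / (1 - x 2 * x 3),
          (1 - x 2) / (1 - x 2 * x 3),
          (1 - x 2) * (1 - x 0 * x 1 * x 2 * x 3) / ((1 - x 0 * x 1 * x 2) * (1 - x 2 * x 3)),
          (1 - x 2) * (1 - x 1 * x 2 * x 3) / ((1 - x 1 * x 2) * (1 - x 2 * x 3))]) f' x
      ∧ f'.det = -(x 1 * x 2 ^ 2 * x 3 * (1 - x 2) ^ 4 * (1 - x 3) ^ 4 /
          ((1 - x 0 * x 1 * x 2) ^ 2 * (1 - x 1 * x 2) ^ 2 * (1 - x 2 * x 3) ^ 6 * (1 - x 3 * x 4) ^ 2)) := by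
  refine ⟨ContinuousLinearMap.pi
    ![(x 3 * (x 3 - 1) * (1 - x 4) / ((1 - x 2 * x 3) ^ 2 * (1 - x 3 * x 4))) • (proj 2 : (Fin 5 → ℝ) →L[ℝ] ℝ)
        + ((1 - x 2) * (1 - x 4) * (1 - x 2 * x 3 ^ 2 * x 4) / ((1 - x 2 * x 3) ^ 2 * (1 - x 3 * x 4) ^ 2)) •
            (proj 3 : (Fin 5 → ℝ) →L[ℝ] ℝ)
        + ((x 3 * (1 - x 2) * (x 3 - 1)) / ((1 - x 2 * x 3) * (1 - x 3 * x 4) ^ 2)) • (proj 4 : (Fin 5 → ℝ) →L[ℝ] ℝ),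
      (x 3 * (x 3 - 1) / (1 - x 2 * x 3) ^ 2) • (proj 2 : (Fin 5 → ℝ) →L[ℝ] ℝ)
        + ((1 - x 2) / (1 - x 2 * x 3) ^ 2) • (proj 3 : (Fin 5 → ℝ) →L[ℝ] ℝ),
      ((x 3 - 1) / (1 - x 2 * x 3) ^ 2) • (proj 2 : (Fin 5 → ℝ) →L[ℝ] ℝ)
        + ((1 - x 2) * x 2 / (1 - x 2 * x 3) ^ 2) • (proj 3 : (Fin 5 → ℝ) →L[ℝ] ℝ),
      ((1 - x 2) * (1 - x 3) * x 1 * x 2 / ((1 - x 2 * x 3) * (1 - x 0 * x 1 * x 2) ^ 2)) • (proj 0 : (Fin 5 → ℝ) →L[ℝ] ℝ)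
        + ((1 - x 2) * (1 - x 3) * x 0 * x 2 / ((1 - x 2 * x 3) * (1 - x 0 * x 1 * x 2) ^ 2)) •
            (proj 1 : (Fin 5 → ℝ) →L[ℝ] ℝ)
        + ((x 3 - 1) * (1 - x 0 * x 1) * (1 - x 0 * x 1 * x 2 ^ 2 * x 3) / ((1 - x 2 * x 3) ^ 2 * (1 - x 0 * x 1 * x 2) ^ 2)) •
            (proj 2 : (Fin 5 → ℝ) →L[ℝ] ℝ)
        + ((1 - x 2) * x 2 * (1 - x 0 * x 1) / ((1 - x 2 * x 3) ^ 2 * (1 - x 0 * x 1 * x 2))) •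
            (proj 3 : (Fin 5 → ℝ) →L[ℝ] ℝ),
      ((1 - x 2) * (1 - x 3) * x 2 / ((1 - x 2 * x 3) * (1 - x 1 * x 2) ^ 2)) • (proj 1 : (Fin 5 → ℝ) →L[ℝ] ℝ)
        + ((x 3 - 1) * (1 - x 1) * (1 - x 1 * x 2 ^ 2 * x 3) / ((1 - x 2 * x 3) ^ 2 * (1 - x 1 * x 2) ^ 2)) •
            (proj 2 : (Fin 5 → ℝ) →L[ℝ] ℝ)
        + ((1 - x 2) * x 2 * (1 - x 1) / ((1 - x 2 * x 3) ^ 2 * (1 - x 1 * x 2))) •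
            (proj 3 : (Fin 5 → ℝ) →L[ℝ] ℝ)], ?_, ?_⟩
  · refine hasFDerivAt_pi'' fun k => ?_
    rw [ContinuousLinearMap.proj_pi]
    fin_cases k
    · simpa using hasFDerivAt_psi0 x hP hQ
    · simpa using hasFDerivAt_psi1 x hP
    · simpa using hasFDerivAt_psi2 x hP
    · simpa using hasFDerivAt_psi3 x hP hU
    · simpa using hasFDerivAt_psi4 x hP hW
  · rw [ContinuousLinearMap.det, ← LinearMap.det_toMatrix']
    rw [show LinearMap.toMatrix' _ = !![0, 0, x 3 * (x 3 - 1) * (1 - x 4) / ((1 - x 2 * x 3) ^ 2 * (1 - x 3 * x 4)),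
          (1 - x 2) * (1 - x 4) * (1 - x 2 * x 3 ^ 2 * x 4) / ((1 - x 2 * x 3) ^ 2 * (1 - x 3 * x 4) ^ 2),
          (x 3 * (1 - x 2) * (x 3 - 1)) / ((1 - x 2 * x 3) * (1 - x 3 * x 4) ^ 2);
        0, 0, x 3 * (x 3 - 1) / (1 - x 2 * x 3) ^ 2, (1 - x 2) / (1 - x 2 * x 3) ^ 2, 0;
        0, 0, (x 3 - 1) / (1 - x 2 * x 3) ^ 2, (1 - x 2) * x 2 / (1 - x 2 * x 3) ^ 2, 0;
        (1 - x 2) * (1 - x 3) * x 1 * x 2 / ((1 - x 2 * x 3) * (1 - x 0 * x 1 * x 2) ^ 2),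
          (1 - x 2) * (1 - x 3) * x 0 * x 2 / ((1 - x 2 * x 3) * (1 - x 0 * x 1 * x 2) ^ 2),
          (x 3 - 1) * (1 - x 0 * x 1) * (1 - x 0 * x 1 * x 2 ^ 2 * x 3) / ((1 - x 2 * x 3) ^ 2 * (1 - x 0 * x 1 * x 2) ^ 2),
          (1 - x 2) * x 2 * (1 - x 0 * x 1) / ((1 - x 2 * x 3) ^ 2 * (1 - x 0 * x 1 * x 2)), 0;
        0, (1 - x 2) * (1 - x 3) * x 2 / ((1 - x 2 * x 3) * (1 - x 1 * x 2) ^ 2),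
          (x 3 - 1) * (1 - x 1) * (1 - x 1 * x 2 ^ 2 * x 3) / ((1 - x 2 * x 3) ^ 2 * (1 - x 1 * x 2) ^ 2),
          (1 - x 2) * x 2 * (1 - x 1) / ((1 - x 2 * x 3) ^ 2 * (1 - x 1 * x 2)), 0] from by
      ext i j
      rw [LinearMap.toMatrix'_apply]
      fin_cases i <;> fin_cases j <;> simp]
    rw [det_pattern14]
    set P := 1 - x 2 * x 3 with hPdef
    set Q := 1 - x 3 * x 4 with hQdef
    set W := 1 - x 1 * x 2 with hWdef
    set U := 1 - x 0 * x 1 * x 2 with hUdef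
    have e : x 3 * (x 3 - 1) / P ^ 2 * ((1 - x 2) * x 2 / P ^ 2) - (1 - x 2) / P ^ 2 * ((x 3 - 1) / P ^ 2)
        = (1 - x 2) * (1 - x 3) / P ^ 3 := by
      have hP3 : P ^ 3 ≠ 0 := pow_ne_zero 3 hP
      have hP4 : P ^ 2 * P ^ 2 ≠ 0 := mul_ne_zero (pow_ne_zero 2 hP) (pow_ne_zero 2 hP)
      rw [div_mul_div_comm, div_mul_div_comm, ← sub_div, div_eq_div_iff hP4 hP3, hPdef]
      ring
    rw [e]
    field_simp
    ring

/-! ### The pointwise identity of the integrands -/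

/-- **Pointwise identity in coordinates:** for `0 < xⱼ < 1` and EVERY `a : Fin 8 → ℤ`,
`|det DΨ(x)| · integrand a (Ψ x) = cubicalIntegrand a x` — every factor `tⱼ − tᵢ`, `1 − tⱼ`, `tⱼ` of the integrand (1) at
`t = Ψ(x)` is a Laurent monomial in the positive atoms (the difference identities of `CellularCubicalMap.lean`); compare logarithms.
[cite: BrownZudilin2022, Sect. 3, (1)→(8) (σ⁵ and the passage from simplicial to cubical coordinates)] -/
theorem integrand_psi_coord (a : Fin 8 → ℤ) (x0 x1 x2 x3 x4 : ℝ)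
    (h0 : 0 < x0) (h0' : x0 < 1) (h1 : 0 < x1) (h1' : x1 < 1) (h2 : 0 < x2) (h2' : x2 < 1)
    (h3 : 0 < x3) (h3' : x3 < 1) (h4 : 0 < x4) (h4' : x4 < 1) :
    x1 * x2 ^ 2 * x3 * (1 - x2) ^ 4 * (1 - x3) ^ 4 /
          ((1 - x0 * x1 * x2) ^ 2 * (1 - x1 * x2) ^ 2 * (1 - x2 * x3) ^ 6 * (1 - x3 * x4) ^ 2) *
        integrand a ![x3 * (1 - x2) * (1 - x4) / ((1 - x2 * x3) * (1 - x3 * x4)),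
          x3 * (1 - x2) / (1 - x2 * x3),
          (1 - x2) / (1 - x2 * x3),
          (1 - x2) * (1 - x0 * x1 * x2 * x3) / ((1 - x0 * x1 * x2) * (1 - x2 * x3)),
          (1 - x2) * (1 - x1 * x2 * x3) / ((1 - x1 * x2) * (1 - x2 * x3))]
      = cubicalIntegrand a ![x0, x1, x2, x3, x4] := by
  have u0 : 0 < 1 - x0 := by linarith
  have u1 : 0 < 1 - x1 := by linarith
  have u2 : 0 < 1 - x2 := by linarith
  have u3 : 0 < 1 - x3 := by linarith
  have u4 : 0 < 1 - x4 := by linarith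
  have p01 : 0 < x0 * x1 := mul_pos h0 h1
  have hV : 0 < 1 - x0 * x1 := by nlinarith [mul_lt_of_lt_one_right h0 h1']
  obtain ⟨hP, hQ, hW, hU⟩ := atoms_pos h0 h0' h1 h1' h2 h2' h3 h3' h4'
  simp only [integrand, cubicalIntegrand, b24, b14, b57, b35, b36, xExp, oneSubExp, linkExp, Matrix.cons_val_zero,
    Matrix.cons_val_one, Matrix.cons_val]
  rw [psi_d10 hP.ne' hQ.ne', psi_d21 hP.ne', psi_d32 hP.ne' hU.ne', psi_d43 hP.ne' hU.ne' hW.ne', psi_d54 hP.ne' hW.ne',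
    psi_d20 hP.ne' hQ.ne', psi_d53 hP.ne' hU.ne', psi_d31 hP.ne' hU.ne', psi_d41 hP.ne' hW.ne']
  set v0 := 1 - x0 with hv0
  set v1 := 1 - x1 with hv1
  set v2 := 1 - x2 with hv2
  set v3 := 1 - x3 with hv3
  set v4 := 1 - x4 with hv4
  set V := 1 - x0 * x1 with hVd
  set W := 1 - x1 * x2 with hWd
  set P := 1 - x2 * x3 with hPd
  set Q := 1 - x3 * x4 with hQd
  set U := 1 - x0 * x1 * x2 with hUd
  clear_value v0 v1 v2 v3 v4 V W P Q U
  refine (Real.log_injOn_pos.eq_iff ?_ ?_).1 ?_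
  · rw [Set.mem_Ioi]; positivity
  · rw [Set.mem_Ioi]; positivity
  simp (disch := positivity) only [Real.log_mul, Real.log_div, Real.log_zpow, Real.log_pow]
  push_cast
  ring

/-- The pointwise identity on the open cube, in the form used by the change of variables.
[cite: BrownZudilin2022, Sect. 3, (1)→(8) (σ⁵ and the passage from simplicial to cubical coordinates)] -/
theorem integrand_psi (a : Fin 8 → ℤ) {x : Fin 5 → ℝ} (hx : x ∈ openCube) :
    x 1 * x 2 ^ 2 * x 3 * (1 - x 2) ^ 4 * (1 - x 3) ^ 4 /
          ((1 - x 0 * x 1 * x 2) ^ 2 * (1 - x 1 * x 2) ^ 2 * (1 - x 2 * x 3) ^ 6 * (1 - x 3 * x 4) ^ 2) *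
        integrand a ![x 3 * (1 - x 2) * (1 - x 4) / ((1 - x 2 * x 3) * (1 - x 3 * x 4)),
          x 3 * (1 - x 2) / (1 - x 2 * x 3),
          (1 - x 2) / (1 - x 2 * x 3),
          (1 - x 2) * (1 - x 0 * x 1 * x 2 * x 3) / ((1 - x 0 * x 1 * x 2) * (1 - x 2 * x 3)),
          (1 - x 2) * (1 - x 1 * x 2 * x 3) / ((1 - x 1 * x 2) * (1 - x 2 * x 3))]
      = cubicalIntegrand a x := by
  obtain ⟨a0, b0⟩ := hx 0; obtain ⟨a1, b1⟩ := hx 1; obtain ⟨a2, b2⟩ := hx 2; obtain ⟨a3, b3⟩ := hx 3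
  obtain ⟨a4, b4⟩ := hx 4
  have hx' : x = ![x 0, x 1, x 2, x 3, x 4] := by ext i; fin_cases i <;> simp
  conv_rhs => rw [hx']
  exact integrand_psi_coord a (x 0) (x 1) (x 2) (x 3) (x 4) a0 b0 a1 b1 a2 b2 a3 b3 a4 b4

/-! ### The change of variables -/

/-- **(8) for every parameter vector:** `cellularIntegral a = cubicalIntegral a` for ALL `a : Fin 8 → ℤ` (no convergence
hypothesis: the change-of-variables formula for the injective differentiable map `Ψ = σ⁵ ∘ c` on the measurable set `(0,1)⁵`,
whose image is the open simplex, holds for the Bochner integral unconditionally).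
[cite: BrownZudilin2022, Sect. 3, (1)→(8) (σ⁵ and the passage from simplicial to cubical coordinates)] -/
theorem cellularIntegral_eq_cubicalIntegral_all (a : Fin 8 → ℤ) : cellularIntegral a = cubicalIntegral a := by
  -- a derivative at every point of the cube (junk `0` elsewhere, where nothing is claimed)
  have hex : ∀ x : Fin 5 → ℝ, ∃ f' : (Fin 5 → ℝ) →L[ℝ] (Fin 5 → ℝ), x ∈ openCube →
      HasFDerivAt (fun x : Fin 5 → ℝ => ![x 3 * (1 - x 2) * (1 - x 4) / ((1 - x 2 * x 3) * (1 - x 3 * x 4)),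
          x 3 * (1 - x 2) / (1 - x 2 * x 3),
          (1 - x 2) / (1 - x 2 * x 3),
          (1 - x 2) * (1 - x 0 * x 1 * x 2 * x 3) / ((1 - x 0 * x 1 * x 2) * (1 - x 2 * x 3)),
          (1 - x 2) * (1 - x 1 * x 2 * x 3) / ((1 - x 1 * x 2) * (1 - x 2 * x 3))]) f' x
        ∧ f'.det = -(x 1 * x 2 ^ 2 * x 3 * (1 - x 2) ^ 4 * (1 - x 3) ^ 4 /
            ((1 - x 0 * x 1 * x 2) ^ 2 * (1 - x 1 * x 2) ^ 2 * (1 - x 2 * x 3) ^ 6 * (1 - x 3 * x 4) ^ 2)) := by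
    intro x
    by_cases hx : x ∈ openCube
    · obtain ⟨hP, hQ, hW, hU⟩ :=
        atoms_pos (hx 0).1 (hx 0).2 (hx 1).1 (hx 1).2 (hx 2).1 (hx 2).2 (hx 3).1 (hx 3).2 (hx 4).2
      obtain ⟨f', hf'⟩ := hasFDerivAt_psi x hP.ne' hQ.ne' hW.ne' hU.ne'
      exact ⟨f', fun _ => hf'⟩
    · exact ⟨0, fun h => (hx h).elim⟩
  choose f' hf' using hex
  have hderiv : ∀ x ∈ openCube, HasFDerivWithinAt
      (fun x : Fin 5 → ℝ => ![x 3 * (1 - x 2) * (1 - x 4) / ((1 - x 2 * x 3) * (1 - x 3 * x 4)),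
          x 3 * (1 - x 2) / (1 - x 2 * x 3),
          (1 - x 2) / (1 - x 2 * x 3),
          (1 - x 2) * (1 - x 0 * x 1 * x 2 * x 3) / ((1 - x 0 * x 1 * x 2) * (1 - x 2 * x 3)),
          (1 - x 2) * (1 - x 1 * x 2 * x 3) / ((1 - x 1 * x 2) * (1 - x 2 * x 3))]) (f' x) openCube x :=
    fun x hx => (hf' x hx).1.hasFDerivWithinAt
  have hcv := integral_image_eq_integral_abs_det_fderiv_smul volume CubicalSubstitution.measurableSet_openCube hderiv
    psi_injOn (integrand a)
  rw [psi_image] at hcv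
  rw [cellularIntegral, hcv, cubicalIntegral]
  refine setIntegral_congr_fun CubicalSubstitution.measurableSet_openCube fun x hx => ?_
  obtain ⟨a0, b0⟩ := hx 0; obtain ⟨a1, b1⟩ := hx 1; obtain ⟨a2, b2⟩ := hx 2; obtain ⟨a3, b3⟩ := hx 3
  obtain ⟨a4, b4⟩ := hx 4
  obtain ⟨hP, hQ, hW, hU⟩ := atoms_pos a0 b0 a1 b1 a2 b2 a3 b3 b4
  have u2 : 0 < 1 - x 2 := by linarith
  have u3 : 0 < 1 - x 3 := by linarith
  rw [(hf' x hx).2, abs_neg, abs_of_pos (by positivity), smul_eq_mul]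
  exact integrand_psi a hx


/-- **Corollary: (1) = (10).** For every `a`, the cellular integral `I(a)` of (1) equals the 12-parameter integral
`J(p(a); q(a))` of (10) (both changes of variables of Sect. 3 composed). [BrownZudilin2022, Sect. 3, (8), (10)–(11)]
[cite: BrownZudilin2022, Sect. 3, (1)→(8) (σ⁵ and the passage from simplicial to cubical coordinates)] -/
theorem cellularIntegral_eq_Jintegral (a : Fin 8 → ℤ) : cellularIntegral a = Jintegral (pOf a) (qOf a) := by
  rw [cellularIntegral_eq_cubicalIntegral_all, CubicalSubstitution.cubicalIntegral_eq_Jintegral_all]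

end Literature.NumberTheory.Irrationality.BrownZudilin2022.CellularCubicalSubstitution

namespace Literature.NumberTheory.Irrationality.BrownZudilin2022

open CellularCubicalSubstitution

/-- **Brown–Zudilin (8) holds:** the named fact `cellularIntegral_eq_cubicalIntegral` of `CubicalForm.lean` ("Applying to the
integral `I(a)` the fifth power of `σ` and passing from simplicial to cubical coordinates … we arrive at the integral (8)") is a
theorem. [BrownZudilin2022, Sect. 3, eq. (8)]
[cite: BrownZudilin2022, Sect. 3, (1)→(8) (σ⁵ and the passage from simplicial to cubical coordinates)] -/
theorem cellularIntegral_eq_cubicalIntegral_holds : cellularIntegral_eq_cubicalIntegral :=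
  fun a _ => cellularIntegral_eq_cubicalIntegral_all a

end Literature.NumberTheory.Irrationality.BrownZudilin2022
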